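/-
Copyright (c) 2026. All rights reserved.
Released under Apache 2.0 license as described in the file LICENSE.
-/
import Literature.NumberTheory.ComplexMultiplication.DegenerateCMTypesElementaryAbelianNine
import Literature.NumberTheory.ComplexMultiplication.DegenerateCMTypesCyclicTwoOddPrimesCount
import HarnessLib

/-!
# Counting the CM types of `⟨ρ⟩ × (ℤ/p)²`: `2^{p²}` types, `Σ_c C(p,c)^p` per direction of equidistribution, and
# the census of Dodson's `⟨ρ⟩ × ℤ₃²` — `342 / 144 / 0 / 24 / 2` types of rank `10 / 8 / 6 / 4 / 2`

B. Dodson, *On the Mumford–Tate group of an abelian variety with complex multiplication*, J. Algebra **111**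
(1987) 49–73 [Dodson1987] (held text `paper:doi-10-1016-0021-8693-87-90242-0`, p. 70 = p0022):

> PROPOSITION 4.4. "(2) Suppose `R₀ = ℤ₃²` and weight(`f`) `= 3`. Then there are the following cases: (a) the
> orbits of order `9` give types with rank(`f`) `= 8` and (b) there are twelve `f` in four `ℤ₃²`-orbits of order
> `3`. […] *Proof.* (2) There is a single Hol(`ℤ₃²`)-orbit of `ℤ₃²`-orbits of order `9`, whose types have rank
> `8`. The four `ℤ₃²`-orbits of order `3` correspond to the four subgroups isomorphic to `ℤ₃` in `ℤ₃²` …"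

Sequel of `DegenerateCMTypesElementaryAbelianPrimeSquare` (row g35-#4: `rank + (p − 1)·t = p² + 1`),
`DegenerateCMTypesElementaryAbelianNine` (row g35-#5: `p = 3`, ranks `{10, 8, 4, 2}`) and the companion of
`DegenerateCMTypesCyclicPrimeSquareCount` (the cyclic minimal group: `450 / 54 / 6 / 2`).  With the frame `(τ, κ)`
and the tree's `rowSet p p S τ κ : ℤ/p → 𝒫(ℤ/p)` (row `y` = `{x : τˣκʸ ∈ S}`) and `typeOfRows p p ρ τ κ r`:

* §1 TYPES ↔ ROW FUNCTIONS: `coord_mem_typeOfRows_iff`, `rho_mul_mem_typeOfRows_iff`, **`isCMTypeWith_typeOfRows`**,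
  `rowSet_typeOfRows`, `typeOfRows_rowSet` (a CM type is the type of its rows), **`ncard_cmTypes_sep_eq_card_filter`**
  (transport of counts along `S ↦ rows(S)`), **`ncard_cmTypes`** (`2^{p²}` CM types — Dodson's `f ∈ ℤ₂⁹`).
* §2 DICTIONARY: `hasConstantRows_iff_card_rowSet`, **`hasConstantRows_diag_iff_rowSet`** (equidistribution over
  `⟨τʲκ⟩` = constant counts `#{y : jy + t ∈ r(y)}` along the lines of slope `j`), `isStableUnder_iff_rowSet`,
  `isStableUnder_diag_iff_rowSet`, `weight_eq_sum_card_rowSet`, `isStableUnder_iff_rowSet_trivial`.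
* §3 EVERY ODD `p`: **`ncard_hasConstantRows`** / `ncard_hasConstantRows_diag` (each of the `p + 1` subgroups of
  order `p` is a direction of equidistribution of `Σ_{c=0}^{p} C(p,c)^p` types), **`ncard_isStableUnder`** /
  `ncard_isStableUnder_diag` (`2^p` types stable under each).
* §4 `p = 3` (`τ, κ` of order `3`, `|G| = 18`): **`ncard_directions_eq_three`** (`342, 144, 0, 24, 2` types with
  `0, 1, 2, 3, 4` directions), **`ncard_typeRank_eq_three`** (THE CENSUS BY RANK: `342` of rank `10`, `144` of rank
  `8` — "a single Hol(`ℤ₃²`)-orbit of `ℤ₃²`-orbits of order `9`": `16` orbits —, `0` of rank `6`, `24` of rank `4`,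
  `2` of rank `2`), `ncard_cmTypes_three` (`512`), **`ncard_weight_three`** (PROP. 4.4 (2) with its numbers: of the
  `84` types of weight `3`, `72` lie in orbits of order `9` — all of rank `8` by
  `typeRank_eq_eight_of_primitive_of_weight_three` — and "twelve `f` in four `ℤ₃²`-orbits of order `3`").
  The combinatorial counts on the `512` row functions `ℤ/3 → 𝒫(ℤ/3)` are checked by the kernel (`decide`).

Compare the cyclic minimal group `⟨ρ⟩ × ℤ₉` (`counts_three`: `450 / 54 / 6 / 2` of rank `10 / 8 / 4 / 2`): over an
abelian CM field of degree `18` the proportion of degenerate primitive types is `54/512` (cyclic) versus `144/512`.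

## References

* [Dodson1987] B. Dodson, J. Algebra 111 (1987) 49–73: §4.1 Prop. 4.1, Example 4.3, Prop. 4.4 (2) (with proof),
  Remark 4.7 (pp. 69–71).
* [Hazama2003CyclicCM] F. Hazama, J. Math. Sci. Univ. Tokyo 10 (2003): Prop. 4.1, Prop. 4.3, Prop. 4.7.
* [Kubota1965] T. Kubota, Trans. AMS 118 (1965), §4 Lemma 2.

## Provenance

Lane `lit-hodgefound` (Track 2, Layer A3 — CM types), seat `lit-hodgefound-p10` generation 35, row g35-#7;
neighbours cited by name, nothing restated: `DegenerateCMTypesElementaryAbelianPrimeSquare` / `…Nine` (frame,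
defect formula, `rowCount_diag`, `isStableUnder_iff_coord`), `DegenerateCMTypesCyclicTwoOddPrimesCount` (`rowSet`,
`typeOfRows`, `card_filter_rows_card_const`, `card_filter_rows_trivial`).
-/

set_option autoImplicit false

noncomputable section

open scoped BigOperators

namespace Literature.NumberTheory.ComplexMultiplication

namespace CyclicCMType

namespace ElemSq

/-! ## §1 CM types of `⟨ρ⟩ × (ℤ/p)²` ↔ row functions `r : ℤ/p → 𝒫(ℤ/p)` in a frame `(τ, κ)` -/

section Matrix

variable {G : Type*} [CommGroup G] [Fintype G] [DecidableEq G] {p : ℕ} [hp : Fact p.Prime] {ρ τ κ : G}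
  {Φ : Finset G}

omit [Fintype G] [DecidableEq G] in
/-- `τ^{(x + x').val} = τ^{x.val} τ^{x'.val}` for `τ` of order `p`. [folklore] -/
private theorem pow_val_add (hτ : orderOf τ = p) (x x' : ZMod p) :
    τ ^ (x + x').val = τ ^ x.val * τ ^ x'.val := by
  haveI : NeZero p := ⟨hp.out.ne_zero⟩
  have h := pow_mod_orderOf τ (x.val + x'.val)
  rw [hτ] at h
  rw [ZMod.val_add, h, pow_add]

omit [Fintype G] [DecidableEq G] in
/-- `τ^{(1 : ℤ/p).val} = τ`. [folklore] -/
private theorem pow_val_one : τ ^ (1 : ZMod p).val = τ := by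
  haveI : Fact (1 < p) := ⟨hp.out.one_lt⟩
  rw [ZMod.val_one, pow_one]

omit [Fintype G] [DecidableEq G] in
/-- `τ · τᵃκᵇ = τ^{a+1} κᵇ`. [folklore] -/
private theorem tau_mul_coord (hτ : orderOf τ = p) (a b : ZMod p) :
    τ * (τ ^ a.val * κ ^ b.val) = τ ^ (a + 1).val * κ ^ b.val := by
  rw [pow_val_add hτ, pow_val_one]; ac_rfl

omit [Fintype G] [DecidableEq G] in
/-- `τʲκ · τᵃκᵇ = τ^{a+j} κ^{b+1}`. [folklore] -/
private theorem diag_mul_coord (hτ : orderOf τ = p) (hκ : orderOf κ = p) (j a b : ZMod p) :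
    τ ^ j.val * κ * (τ ^ a.val * κ ^ b.val) = τ ^ (a + j).val * κ ^ (b + 1).val := by
  rw [pow_val_add hτ, pow_val_add hκ, pow_val_one]; ac_rfl

omit [DecidableEq G] in
/-- In `⟨ρ⟩ × ⟨τ⟩ × ⟨κ⟩` no `ρτˣκʸ` is a `τˣ'κʸ'`. [folklore] -/
private theorem rho_mul_ne (hp2 : p ≠ 2) (hτ : orderOf τ = p) (hκ : orderOf κ = p)
    (hτκ : κ ∉ Subgroup.zpowers τ) (hcard : Fintype.card G = 2 * p ^ 2) (hρ1 : ρ ≠ 1) (hρ2 : ρ * ρ = 1)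
    (x y x' y' : ZMod p) : ρ * (τ ^ x.val * κ ^ y.val) ≠ τ ^ x'.val * κ ^ y'.val := fun h =>
  Sum.inr_ne_inl ((coord_bijective hp2 hτ hκ hτκ hcard hρ1 hρ2).1 (a₁ := Sum.inr (x, y))
    (a₂ := Sum.inl (x', y')) h)

/-- **`τˣκʸ ∈ S(r) ↔ x ∈ r(y)`** for the type `S(r)` with prescribed rows (the tree's `typeOfRows p p ρ τ κ r`):
Dodson's "`f ∈ ℤ₂⁹` defines a type on `⟨ρ⟩ × R₀`", `R₀ = ℤ₃²`. [cite: Dodson1987, Prop. 4.1] [cite: Hazama2003CyclicCM, Prop. 4.1] -/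
theorem coord_mem_typeOfRows_iff (hp2 : p ≠ 2) (hτ : orderOf τ = p) (hκ : orderOf κ = p)
    (hτκ : κ ∉ Subgroup.zpowers τ) (hcard : Fintype.card G = 2 * p ^ 2) (hρ1 : ρ ≠ 1) (hρ2 : ρ * ρ = 1)
    (r : ZMod p → Finset (ZMod p)) (x y : ZMod p) :
    haveI : NeZero p := ⟨hp.out.ne_zero⟩
    τ ^ x.val * κ ^ y.val ∈ typeOfRows p p ρ τ κ r ↔ x ∈ r y := by
  haveI : NeZero p := ⟨hp.out.ne_zero⟩
  unfold typeOfRows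
  rw [Finset.mem_image]
  constructor
  · rintro ⟨⟨x', y'⟩, -, h⟩
    dsimp only at h
    split_ifs at h with hc
    · obtain ⟨rfl, rfl⟩ := Prod.mk.inj (pow_mul_pow_injective hτ hκ hτκ h)
      exact hc
    · exact absurd h (rho_mul_ne hp2 hτ hκ hτκ hcard hρ1 hρ2 _ _ _ _)
  · intro hx
    exact ⟨(x, y), Finset.mem_univ _, by simp [hx]⟩

/-- **`ρτˣκʸ ∈ S(r) ↔ x ∉ r(y)`.** [cite: Dodson1987, Prop. 4.1] [cite: Hazama2003CyclicCM, Prop. 4.1] -/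
theorem rho_mul_mem_typeOfRows_iff (hp2 : p ≠ 2) (hτ : orderOf τ = p) (hκ : orderOf κ = p)
    (hτκ : κ ∉ Subgroup.zpowers τ) (hcard : Fintype.card G = 2 * p ^ 2) (hρ1 : ρ ≠ 1) (hρ2 : ρ * ρ = 1)
    (r : ZMod p → Finset (ZMod p)) (x y : ZMod p) :
    haveI : NeZero p := ⟨hp.out.ne_zero⟩
    ρ * (τ ^ x.val * κ ^ y.val) ∈ typeOfRows p p ρ τ κ r ↔ x ∉ r y := by
  haveI : NeZero p := ⟨hp.out.ne_zero⟩
  unfold typeOfRows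
  rw [Finset.mem_image]
  constructor
  · rintro ⟨⟨x', y'⟩, -, h⟩
    dsimp only at h
    split_ifs at h with hc
    · exact absurd h.symm (rho_mul_ne hp2 hτ hκ hτκ hcard hρ1 hρ2 _ _ _ _)
    · obtain ⟨rfl, rfl⟩ := Prod.mk.inj (pow_mul_pow_injective hτ hκ hτκ (mul_left_cancel h))
      exact hc
  · intro hx
    exact ⟨(x, y), Finset.mem_univ _, by simp [hx]⟩

/-- **`S(r)` is a CM type for `ρ`** on `⟨ρ⟩ × (ℤ/p)²`. [cite: Dodson1987, Prop. 4.1] [cite: Hazama2003CyclicCM, Prop. 4.1] -/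
theorem isCMTypeWith_typeOfRows (hp2 : p ≠ 2) (hτ : orderOf τ = p) (hκ : orderOf κ = p)
    (hτκ : κ ∉ Subgroup.zpowers τ) (hcard : Fintype.card G = 2 * p ^ 2) (hρ1 : ρ ≠ 1) (hρ2 : ρ * ρ = 1)
    (r : ZMod p → Finset (ZMod p)) :
    haveI : NeZero p := ⟨hp.out.ne_zero⟩
    IsCMTypeWith ρ (typeOfRows p p ρ τ κ r : Set G) := by
  haveI : NeZero p := ⟨hp.out.ne_zero⟩
  refine ⟨fun g => ?_, fun g x => ?_, fun x => ?_⟩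
  · obtain ⟨⟨x, y⟩, rfl | rfl⟩ := exists_coord hp2 hτ hκ hτκ hcard hρ1 hρ2 g
    · rw [Finset.mem_coe, smul_eq_mul, Finset.mem_coe, coord_mem_typeOfRows_iff hp2 hτ hκ hτκ hcard hρ1 hρ2,
        rho_mul_mem_typeOfRows_iff hp2 hτ hκ hτκ hcard hρ1 hρ2, not_not]
    · rw [Finset.mem_coe, smul_eq_mul, Finset.mem_coe,
        show ρ * (ρ * (τ ^ x.val * κ ^ y.val)) = τ ^ x.val * κ ^ y.val by rw [← mul_assoc, hρ2, one_mul],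
        coord_mem_typeOfRows_iff hp2 hτ hκ hτκ hcard hρ1 hρ2,
        rho_mul_mem_typeOfRows_iff hp2 hτ hκ hτκ hcard hρ1 hρ2]
  · change g * (ρ * x) = ρ * (g * x)
    rw [mul_left_comm]
  · change ρ * (ρ * x) = x
    rw [← mul_assoc, hρ2, one_mul]

omit [Fintype G] in
/-- The rows of `S(r)` are `r`. [cite: Hazama2003CyclicCM, Prop. 4.1] -/
theorem rowSet_typeOfRows (hp2 : p ≠ 2) (hτ : orderOf τ = p) (hκ : orderOf κ = p)
    (hτκ : κ ∉ Subgroup.zpowers τ) [Fintype G] (hcard : Fintype.card G = 2 * p ^ 2) (hρ1 : ρ ≠ 1)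
    (hρ2 : ρ * ρ = 1) (r : ZMod p → Finset (ZMod p)) :
    haveI : NeZero p := ⟨hp.out.ne_zero⟩
    rowSet p p (typeOfRows p p ρ τ κ r) τ κ = r := by
  funext y
  ext x
  rw [mem_rowSet_iff, coord_mem_typeOfRows_iff hp2 hτ hκ hτκ hcard hρ1 hρ2]

/-- **A CM type of `⟨ρ⟩ × (ℤ/p)²` is the type of its rows** (types `↔ f ∈ ℤ₂^{p²}`). [cite: Dodson1987, Prop. 4.1]
[cite: Hazama2003CyclicCM, Prop. 4.1] -/
theorem typeOfRows_rowSet (hp2 : p ≠ 2) (hτ : orderOf τ = p) (hκ : orderOf κ = p)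
    (hτκ : κ ∉ Subgroup.zpowers τ) (hcard : Fintype.card G = 2 * p ^ 2) (h : IsCMTypeWith ρ (Φ : Set G)) :
    haveI : NeZero p := ⟨hp.out.ne_zero⟩
    typeOfRows p p ρ τ κ (rowSet p p Φ τ κ) = Φ := by
  haveI : NeZero p := ⟨hp.out.ne_zero⟩
  have hρ2 : ρ * ρ = 1 := by
    have := h.invol (1 : G)
    simpa [smul_eq_mul] using this
  have hρ1 : ρ ≠ 1 := by
    intro hρ
    have := h.rho_smul_ne (1 : G)
    rw [hρ, smul_eq_mul, one_mul] at this
    exact this rfl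
  ext g
  obtain ⟨⟨x, y⟩, rfl | rfl⟩ := exists_coord hp2 hτ hκ hτκ hcard hρ1 hρ2 g
  · rw [coord_mem_typeOfRows_iff hp2 hτ hκ hτκ hcard hρ1 hρ2, mem_rowSet_iff]
  · rw [rho_mul_mem_typeOfRows_iff hp2 hτ hκ hτκ hcard hρ1 hρ2, mem_rowSet_iff, rho_mul_mem_iff h]

/-- Counting a set cut out of a finite type by a predicate. [folklore] -/
private theorem ncard_setOf_eq_card_filter {α : Type*} [Fintype α] (P : α → Prop) [DecidablePred P] :
    {a : α | P a}.ncard = (Finset.univ.filter P).card := by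
  rw [← Set.ncard_coe_finset]
  congr 1
  ext a
  simp

/-- **Transport of counts**: for predicates `P` on types and `Q` on row functions that agree under `S ↦ rows(S)`,
`#{S CM type : P(S)} = #{r : Q(r)}`. [cite: Dodson1987, Prop. 4.1] [cite: Hazama2003CyclicCM, Prop. 4.1] -/
theorem ncard_cmTypes_sep_eq_card_filter (hp2 : p ≠ 2) (hτ : orderOf τ = p) (hκ : orderOf κ = p)
    (hτκ : κ ∉ Subgroup.zpowers τ) (hcard : Fintype.card G = 2 * p ^ 2) (hρ1 : ρ ≠ 1) (hρ2 : ρ * ρ = 1)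
    (P : Finset G → Prop) (Q : (ZMod p → Finset (ZMod p)) → Prop) [DecidablePred Q]
    (hPQ : haveI : NeZero p := ⟨hp.out.ne_zero⟩
      ∀ Φ : Finset G, IsCMTypeWith ρ (Φ : Set G) → (P Φ ↔ Q (rowSet p p Φ τ κ))) :
    {Φ : Finset G | IsCMTypeWith ρ (Φ : Set G) ∧ P Φ}.ncard = (Finset.univ.filter Q).card := by
  haveI : NeZero p := ⟨hp.out.ne_zero⟩
  classical
  rw [ncard_setOf_eq_card_filter]
  refine Finset.card_bij (fun Φ _ => rowSet p p Φ τ κ) (fun Φ hΦ => ?_) (fun Φ₁ h₁ Φ₂ h₂ h => ?_)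
    (fun r hr => ?_)
  · rw [Finset.mem_filter] at hΦ ⊢
    exact ⟨Finset.mem_univ _, (hPQ Φ hΦ.2.1).1 hΦ.2.2⟩
  · rw [Finset.mem_filter] at h₁ h₂
    rw [← typeOfRows_rowSet hp2 hτ hκ hτκ hcard h₁.2.1, ← typeOfRows_rowSet hp2 hτ hκ hτκ hcard h₂.2.1, h]
  · rw [Finset.mem_filter] at hr
    refine ⟨typeOfRows p p ρ τ κ r, ?_, rowSet_typeOfRows hp2 hτ hκ hτκ hcard hρ1 hρ2 r⟩
    rw [Finset.mem_filter]
    refine ⟨Finset.mem_univ _, isCMTypeWith_typeOfRows hp2 hτ hκ hτκ hcard hρ1 hρ2 r, ?_⟩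
    rw [hPQ _ (isCMTypeWith_typeOfRows hp2 hτ hκ hτκ hcard hρ1 hρ2 r),
      rowSet_typeOfRows hp2 hτ hκ hτκ hcard hρ1 hρ2]
    exact hr.2

/-- **There are `2^{p²}` CM types for `ρ`** on `⟨ρ⟩ × (ℤ/p)²` (Dodson's `f ∈ ℤ₂⁹`: `512` for `p = 3`).
[cite: Dodson1987, Prop. 4.1] -/
theorem ncard_cmTypes (hp2 : p ≠ 2) (hτ : orderOf τ = p) (hκ : orderOf κ = p)
    (hτκ : κ ∉ Subgroup.zpowers τ) (hcard : Fintype.card G = 2 * p ^ 2) (hρ1 : ρ ≠ 1) (hρ2 : ρ * ρ = 1) :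
    {Φ : Finset G | IsCMTypeWith ρ (Φ : Set G)}.ncard = 2 ^ (p ^ 2) := by
  haveI : NeZero p := ⟨hp.out.ne_zero⟩
  classical
  have h := ncard_cmTypes_sep_eq_card_filter hp2 hτ hκ hτκ hcard hρ1 hρ2 (fun _ => True) (fun _ => True)
    fun _ _ => Iff.rfl
  simp only [and_true, Finset.filter_true_of_mem (fun _ _ => trivial), Finset.card_univ, Fintype.card_fun,
    Fintype.card_finset, ZMod.card] at h
  rw [h, ← pow_mul, sq]

end Matrix

/-! ## §2 The classes read on the rows -/

section Dictionary

variable {G : Type*} [CommGroup G] [Fintype G] [DecidableEq G] {p : ℕ} [hp : Fact p.Prime] {ρ τ κ : G}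
  {Φ : Finset G}

omit [Fintype G] in
/-- Equidistribution over the cosets of `⟨τ⟩` read on the rows. [cite: Hazama2003CyclicCM, Prop. 4.3] -/
theorem hasConstantRows_iff_card_rowSet :
    haveI : NeZero p := ⟨hp.out.ne_zero⟩
    HasConstantRows p p Φ τ κ ↔ ∀ y y' : ZMod p, (rowSet p p Φ τ κ y).card = (rowSet p p Φ τ κ y').card :=
  Iff.rfl

omit [Fintype G] in
/-- **Equidistribution over the cosets of `⟨τʲκ⟩` read on the rows**: the counts
`#{y : jy + t ∈ r(y)}` along the lines of slope `j` are constant in `t`. [cite: Dodson1987, Prop. 4.4 (2) (proof)] -/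
theorem hasConstantRows_diag_iff_rowSet (hτ : orderOf τ = p) (hκ : orderOf κ = p) (j : ZMod p) :
    haveI : NeZero p := ⟨hp.out.ne_zero⟩
    HasConstantRows p p Φ (τ ^ j.val * κ) τ ↔ ∀ t t' : ZMod p,
      (Finset.univ.filter fun y : ZMod p => j * y + t ∈ rowSet p p Φ τ κ y).card =
        (Finset.univ.filter fun y : ZMod p => j * y + t' ∈ rowSet p p Φ τ κ y).card := by
  haveI : NeZero p := ⟨hp.out.ne_zero⟩
  unfold HasConstantRows
  simp_rw [rowCount_diag hτ hκ, mem_rowSet_iff]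

/-- **`τ`-stability read on the rows**: every row is invariant under `x ↦ x + 1`. [cite: Dodson1987, Prop. 4.4 (2)(b)] -/
theorem isStableUnder_iff_rowSet (hp2 : p ≠ 2) (hτ : orderOf τ = p) (hκ : orderOf κ = p)
    (hτκ : κ ∉ Subgroup.zpowers τ) (hcard : Fintype.card G = 2 * p ^ 2) (h : IsCMTypeWith ρ (Φ : Set G)) :
    haveI : NeZero p := ⟨hp.out.ne_zero⟩
    IsStableUnder Φ τ ↔ ∀ x y : ZMod p, x ∈ rowSet p p Φ τ κ y ↔ x + 1 ∈ rowSet p p Φ τ κ y := by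
  haveI : NeZero p := ⟨hp.out.ne_zero⟩
  rw [isStableUnder_iff_coord hp2 hτ hκ hτκ hcard h]
  simp_rw [mem_rowSet_iff, tau_mul_coord hτ]

/-- **`τʲκ`-stability read on the rows**: `x ∈ r(y) ↔ x + j ∈ r(y + 1)`. [cite: Dodson1987, Prop. 4.4 (2)(b)] -/
theorem isStableUnder_diag_iff_rowSet (hp2 : p ≠ 2) (hτ : orderOf τ = p) (hκ : orderOf κ = p)
    (hτκ : κ ∉ Subgroup.zpowers τ) (hcard : Fintype.card G = 2 * p ^ 2) (h : IsCMTypeWith ρ (Φ : Set G))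
    (j : ZMod p) :
    haveI : NeZero p := ⟨hp.out.ne_zero⟩
    IsStableUnder Φ (τ ^ j.val * κ) ↔
      ∀ x y : ZMod p, x ∈ rowSet p p Φ τ κ y ↔ x + j ∈ rowSet p p Φ τ κ (y + 1) := by
  haveI : NeZero p := ⟨hp.out.ne_zero⟩
  rw [isStableUnder_iff_coord hp2 hτ hκ hτκ hcard h]
  simp_rw [mem_rowSet_iff, diag_mul_coord hτ hκ]

omit [Fintype G] in
/-- The weight `#{(x,y) : τˣκʸ ∈ S}` read on the rows. [cite: Dodson1987, Prop. 4.1] -/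
theorem weight_eq_sum_card_rowSet :
    haveI : NeZero p := ⟨hp.out.ne_zero⟩
    (Finset.univ.filter fun xy : ZMod p × ZMod p => τ ^ xy.1.val * κ ^ xy.2.val ∈ Φ).card =
      ∑ y : ZMod p, (rowSet p p Φ τ κ y).card := by
  haveI : NeZero p := ⟨hp.out.ne_zero⟩
  rw [← sum_rowCount_eq p p Φ τ κ]
  rfl

/-- A `1`-periodic subset of `ℤ/p` is `∅` or everything. [folklore] -/
private theorem eq_empty_or_univ_of_periodic {A : Finset (ZMod p)} (hA : ∀ x, x ∈ A ↔ x + 1 ∈ A) :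
    A = ∅ ∨ A = Finset.univ := by
  haveI : NeZero p := ⟨hp.out.ne_zero⟩
  have hn : ∀ n : ℕ, ((n : ZMod p) ∈ A ↔ (0 : ZMod p) ∈ A) := by
    intro n
    induction n with
    | zero => rw [Nat.cast_zero]
    | succ n ih => rw [Nat.cast_succ, ← hA, ih]
  have key : ∀ x : ZMod p, x ∈ A ↔ (0 : ZMod p) ∈ A := fun x => by
    rw [← ZMod.natCast_zmod_val x]; exact hn x.val
  by_cases h0 : (0 : ZMod p) ∈ A
  · right; ext x; simp only [Finset.mem_univ, iff_true]; exact (key x).2 h0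
  · left; ext x; simp only [Finset.notMem_empty, iff_false]; exact fun hx => h0 ((key x).1 hx)

/-- **`τ`-stable iff every row is `∅` or `ℤ/p`.** [cite: Dodson1987, Prop. 4.4 (2)(b)] [cite: Hazama2003CyclicCM, Prop. 4.7] -/
theorem isStableUnder_iff_rowSet_trivial (hp2 : p ≠ 2) (hτ : orderOf τ = p) (hκ : orderOf κ = p)
    (hτκ : κ ∉ Subgroup.zpowers τ) (hcard : Fintype.card G = 2 * p ^ 2) (h : IsCMTypeWith ρ (Φ : Set G)) :
    haveI : NeZero p := ⟨hp.out.ne_zero⟩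
    IsStableUnder Φ τ ↔ ∀ y : ZMod p, rowSet p p Φ τ κ y = ∅ ∨ rowSet p p Φ τ κ y = Finset.univ := by
  rw [isStableUnder_iff_rowSet hp2 hτ hκ hτκ hcard h]
  constructor
  · intro H y
    exact eq_empty_or_univ_of_periodic fun x => H x y
  · intro H x y
    rcases H y with e | e
    · rw [e]; simp
    · rw [e]; simp

end Dictionary

/-! ## §3 Counts for every odd prime `p` -/

section Counts

variable {G : Type*} [CommGroup G] [Fintype G] [DecidableEq G] {p : ℕ} [hp : Fact p.Prime] {ρ τ κ : G}

/-- **`#{S : S equidistributed over the cosets of ⟨τ⟩} = Σ_{c=0}^{p} C(p,c)^p`** (the `p × p` `(0,1)`-matrices with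
constant row sum). [cite: Dodson1987, Prop. 4.4 (2)] [cite: Hazama2003CyclicCM, Prop. 4.3] -/
theorem ncard_hasConstantRows (hp2 : p ≠ 2) (hτ : orderOf τ = p) (hκ : orderOf κ = p)
    (hτκ : κ ∉ Subgroup.zpowers τ) (hcard : Fintype.card G = 2 * p ^ 2) (hρ1 : ρ ≠ 1) (hρ2 : ρ * ρ = 1) :
    haveI : NeZero p := ⟨hp.out.ne_zero⟩
    {Φ : Finset G | IsCMTypeWith ρ (Φ : Set G) ∧ HasConstantRows p p Φ τ κ}.ncard =
      ∑ i ∈ Finset.range (p + 1), p.choose i ^ p := by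
  haveI : NeZero p := ⟨hp.out.ne_zero⟩
  classical
  rw [ncard_cmTypes_sep_eq_card_filter hp2 hτ hκ hτκ hcard hρ1 hρ2 (fun Φ => HasConstantRows p p Φ τ κ)
    (fun r : ZMod p → Finset (ZMod p) => ∀ y y', (r y).card = (r y').card) fun Φ _ => Iff.rfl]
  exact card_filter_rows_card_const p p

/-- **The same count for each diagonal direction `⟨τʲκ⟩`** (the frame `(τʲκ, τ)`): every one of the `p + 1`
subgroups of order `p` is the direction of equidistribution of `Σ_c C(p,c)^p` types. [cite: Dodson1987, Prop. 4.4 (2)] -/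
theorem ncard_hasConstantRows_diag (hp2 : p ≠ 2) (hτ : orderOf τ = p) (hκ : orderOf κ = p)
    (hτκ : κ ∉ Subgroup.zpowers τ) (hcard : Fintype.card G = 2 * p ^ 2) (hρ1 : ρ ≠ 1) (hρ2 : ρ * ρ = 1)
    (j : ZMod p) :
    haveI : NeZero p := ⟨hp.out.ne_zero⟩
    {Φ : Finset G | IsCMTypeWith ρ (Φ : Set G) ∧ HasConstantRows p p Φ (τ ^ j.val * κ) τ}.ncard =
      ∑ i ∈ Finset.range (p + 1), p.choose i ^ p :=
  ncard_hasConstantRows hp2 (frame_change hτ hκ hτκ j.val).1 hτ (frame_change hτ hκ hτκ j.val).2 hcard hρ1 hρ2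

/-- **`#{S : τS = S} = 2^p`** (each coset of `⟨τ⟩` in or out): the types in the orbits of order `≤ p` for the
direction `⟨τ⟩`. [cite: Dodson1987, Prop. 4.4 (2)(b)] [cite: Hazama2003CyclicCM, Prop. 4.7] -/
theorem ncard_isStableUnder (hp2 : p ≠ 2) (hτ : orderOf τ = p) (hκ : orderOf κ = p)
    (hτκ : κ ∉ Subgroup.zpowers τ) (hcard : Fintype.card G = 2 * p ^ 2) (hρ1 : ρ ≠ 1) (hρ2 : ρ * ρ = 1) :
    {Φ : Finset G | IsCMTypeWith ρ (Φ : Set G) ∧ IsStableUnder Φ τ}.ncard = 2 ^ p := by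
  haveI : NeZero p := ⟨hp.out.ne_zero⟩
  classical
  rw [ncard_cmTypes_sep_eq_card_filter hp2 hτ hκ hτκ hcard hρ1 hρ2 (fun Φ => IsStableUnder Φ τ)
    (fun r : ZMod p → Finset (ZMod p) => ∀ y, r y = ∅ ∨ r y = Finset.univ)
    fun Φ h => isStableUnder_iff_rowSet_trivial hp2 hτ hκ hτκ hcard h]
  exact card_filter_rows_trivial p p

/-- **`#{S : τʲκ S = S} = 2^p`** for every diagonal direction. [cite: Dodson1987, Prop. 4.4 (2)(b)] -/
theorem ncard_isStableUnder_diag (hp2 : p ≠ 2) (hτ : orderOf τ = p) (hκ : orderOf κ = p)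
    (hτκ : κ ∉ Subgroup.zpowers τ) (hcard : Fintype.card G = 2 * p ^ 2) (hρ1 : ρ ≠ 1) (hρ2 : ρ * ρ = 1)
    (j : ZMod p) :
    {Φ : Finset G | IsCMTypeWith ρ (Φ : Set G) ∧ IsStableUnder Φ (τ ^ j.val * κ)}.ncard = 2 ^ p :=
  ncard_isStableUnder hp2 (frame_change hτ hκ hτκ j.val).1 hτ (frame_change hτ hκ hτκ j.val).2 hcard hρ1 hρ2

end Counts

/-! ## §4 `p = 3`: the census of the `512` CM types of `⟨ρ⟩ × ℤ₃²` (Dodson's Prop. 4.4 (2) with its numbers) -/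

section Three

variable {G : Type*} [CommGroup G] [Fintype G] [DecidableEq G] {ρ τ κ : G} {Φ : Finset G}

/-! ### The kernel's count on the `512` row functions `r : ℤ/3 → 𝒫(ℤ/3)` -/

/-- Row functions with `n` directions of equidistribution: `342, 144, 0, 24, 2` for `n = 0, 1, 2, 3, 4`. [folklore] -/
private theorem card_rows_directions_three (n : ℕ) (hn : n ≤ 4) :
    (Finset.univ.filter fun r : ZMod 3 → Finset (ZMod 3) =>
      (if (∀ y y' : ZMod 3, (r y).card = (r y').card) then 1 else 0) +
        (Finset.univ.filter fun j : ZMod 3 => ∀ t t' : ZMod 3,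
          (Finset.univ.filter fun y : ZMod 3 => j * y + t ∈ r y).card =
            (Finset.univ.filter fun y : ZMod 3 => j * y + t' ∈ r y).card).card = n).card =
      if n = 0 then 342 else if n = 1 then 144 else if n = 2 then 0 else if n = 3 then 24 else 2 := by
  interval_cases n <;> decide +kernel

/-- Weight-`3` row functions (`Σ_y #r(y) = 3`) invariant under no translation `(1,0)`, `(j,1)`: `72`; under some: `12`.
[folklore] -/
private theorem card_rows_weight_three :
    (Finset.univ.filter fun r : ZMod 3 → Finset (ZMod 3) => ∑ y : ZMod 3, (r y).card = 3 ∧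
      (¬ (∀ x y : ZMod 3, x ∈ r y ↔ x + 1 ∈ r y) ∧
        ∀ j : ZMod 3, ¬ ∀ x y : ZMod 3, x ∈ r y ↔ x + j ∈ r (y + 1))).card = 72 ∧
    (Finset.univ.filter fun r : ZMod 3 → Finset (ZMod 3) => ∑ y : ZMod 3, (r y).card = 3 ∧
      ¬ (¬ (∀ x y : ZMod 3, x ∈ r y ↔ x + 1 ∈ r y) ∧
        ∀ j : ZMod 3, ¬ ∀ x y : ZMod 3, x ∈ r y ↔ x + j ∈ r (y + 1))).card = 12 := by
  constructor <;> decide +kernel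

/-! ### Transport to the CM types -/

/-- `[P] = [Q]` as numbers for equivalent propositions. [folklore] -/
private theorem ite_congr_prop {P Q : Prop} [Decidable P] [Decidable Q] (h : P ↔ Q) :
    (if P then 1 else 0 : ℕ) = if Q then 1 else 0 := by
  by_cases hq : Q
  · rw [if_pos hq, if_pos (h.2 hq)]
  · rw [if_neg hq, if_neg (mt h.1 hq)]

omit [Fintype G] in
open scoped Classical in
/-- **The number of directions of a type read on its rows.** [cite: Dodson1987, Prop. 4.4 (2) (proof)] -/
theorem directions_eq_rowSet (hτ : orderOf τ = 3) (hκ : orderOf κ = 3) :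
    (if HasConstantRows 3 3 Φ τ κ then 1 else 0) +
        (Finset.univ.filter fun j : ZMod 3 => HasConstantRows 3 3 Φ (τ ^ j.val * κ) τ).card =
      (if (∀ y y' : ZMod 3, (rowSet 3 3 Φ τ κ y).card = (rowSet 3 3 Φ τ κ y').card) then 1 else 0) +
        (Finset.univ.filter fun j : ZMod 3 => ∀ t t' : ZMod 3,
          (Finset.univ.filter fun y : ZMod 3 => j * y + t ∈ rowSet 3 3 Φ τ κ y).card =
            (Finset.univ.filter fun y : ZMod 3 => j * y + t' ∈ rowSet 3 3 Φ τ κ y).card).card := by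
  rw [ite_congr_prop (hasConstantRows_iff_card_rowSet (p := 3) (Φ := Φ) (τ := τ) (κ := κ))]
  congr 1
  congr 1
  exact Finset.filter_congr fun j _ => hasConstantRows_diag_iff_rowSet hτ hκ j

open scoped Classical in
/-- **THE CENSUS BY DIRECTIONS**: among the `512` CM types of `⟨ρ⟩ × ℤ₃²`, `342` are equidistributed in no
direction, `144` in exactly one, NONE in exactly two, `24` in three (the cosets of a `ℤ₃` and their complements:
Dodson's orbits of order `3`, "twelve `f` in four `ℤ₃²`-orbits of order `3`" for each of the weights `3`, `6`),
`2` in all four (`S ⊇ ℤ₃²`, `S ∩ ℤ₃² = ∅`). [cite: Dodson1987, Prop. 4.4 (2)] -/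
theorem ncard_directions_eq_three (hτ : orderOf τ = 3) (hκ : orderOf κ = 3) (hτκ : κ ∉ Subgroup.zpowers τ)
    (hcard : Fintype.card G = 18) (hρ1 : ρ ≠ 1) (hρ2 : ρ * ρ = 1) (n : ℕ) (hn : n ≤ 4) :
    {Φ : Finset G | IsCMTypeWith ρ (Φ : Set G) ∧
      (if HasConstantRows 3 3 Φ τ κ then 1 else 0) +
        (Finset.univ.filter fun j : ZMod 3 => HasConstantRows 3 3 Φ (τ ^ j.val * κ) τ).card = n}.ncard =
      if n = 0 then 342 else if n = 1 then 144 else if n = 2 then 0 else if n = 3 then 24 else 2 := by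
  rw [← card_rows_directions_three n hn]
  refine ncard_cmTypes_sep_eq_card_filter (p := 3) (by norm_num) hτ hκ hτκ (by rw [hcard]; norm_num) hρ1 hρ2 _ _
    fun Φ _ => ?_
  rw [directions_eq_rowSet hτ hκ]

open scoped Classical in
/-- **THE CENSUS BY RANK: `342` types of rank `10`, `144` of rank `8`, none of rank `6`, `24` of rank `4`, `2` of
rank `2`** (rank `= 10 − 2·`directions). The `144` rank-`8` types are Dodson's "single Hol(`ℤ₃²`)-orbit of
`ℤ₃²`-orbits of order `9`, whose types have rank `8`" (`72` of weight `3`, `72` of weight `6`: `16` orbits).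
[cite: Dodson1987, Prop. 4.4 (2) and Remark 4.7] [cite: Kubota1965, §4 Lemma 2] -/
theorem ncard_typeRank_eq_three (hτ : orderOf τ = 3) (hκ : orderOf κ = 3) (hτκ : κ ∉ Subgroup.zpowers τ)
    (hcard : Fintype.card G = 18) (hρ1 : ρ ≠ 1) (hρ2 : ρ * ρ = 1) :
    {Φ : Finset G | IsCMTypeWith ρ (Φ : Set G) ∧ typeRank G (Φ : Set G) = 10}.ncard = 342 ∧
    {Φ : Finset G | IsCMTypeWith ρ (Φ : Set G) ∧ typeRank G (Φ : Set G) = 8}.ncard = 144 ∧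
    {Φ : Finset G | IsCMTypeWith ρ (Φ : Set G) ∧ typeRank G (Φ : Set G) = 6}.ncard = 0 ∧
    {Φ : Finset G | IsCMTypeWith ρ (Φ : Set G) ∧ typeRank G (Φ : Set G) = 4}.ncard = 24 ∧
    {Φ : Finset G | IsCMTypeWith ρ (Φ : Set G) ∧ typeRank G (Φ : Set G) = 2}.ncard = 2 := by
  have key : ∀ (rk n : ℕ), rk + 2 * n = 10 → n ≤ 4 →
      {Φ : Finset G | IsCMTypeWith ρ (Φ : Set G) ∧ typeRank G (Φ : Set G) = rk}.ncard =
        if n = 0 then 342 else if n = 1 then 144 else if n = 2 then 0 else if n = 3 then 24 else 2 := by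
    intro rk n hrk hn
    rw [← ncard_directions_eq_three hτ hκ hτκ hcard hρ1 hρ2 n hn]
    congr 1
    ext Φ
    simp only [Set.mem_setOf_eq]
    refine ⟨fun ⟨h, hr⟩ => ⟨h, ?_⟩, fun ⟨h, hd⟩ => ⟨h, ?_⟩⟩
    · have := typeRank_add_defect_eq_nine hτ hκ hτκ hcard h
      omega
    · have := typeRank_add_defect_eq_nine hτ hκ hτκ hcard h
      omega
  refine ⟨?_, ?_, ?_, ?_, ?_⟩
  · simpa using key 10 0 (by norm_num) (by norm_num)
  · simpa using key 8 1 (by norm_num) (by norm_num)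
  · simpa using key 6 2 (by norm_num) (by norm_num)
  · simpa using key 4 3 (by norm_num) (by norm_num)
  · simpa using key 2 4 (by norm_num) (by norm_num)

/-- **The total: `512` CM types, `144 = 512 − 342 − 24 − 2` degenerate primitive ones.** [cite: Dodson1987, Prop. 4.1 and Prop. 4.4 (2)] -/
theorem ncard_cmTypes_three (hτ : orderOf τ = 3) (hκ : orderOf κ = 3) (hτκ : κ ∉ Subgroup.zpowers τ)
    (hcard : Fintype.card G = 18) (hρ1 : ρ ≠ 1) (hρ2 : ρ * ρ = 1) :
    {Φ : Finset G | IsCMTypeWith ρ (Φ : Set G)}.ncard = 512 := by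
  rw [ncard_cmTypes (p := 3) (by norm_num) hτ hκ hτκ (by rw [hcard]; norm_num) hρ1 hρ2]; norm_num

open scoped Classical in
/-- **PROP. 4.4 (2) WITH ITS NUMBERS: "Suppose `R₀ = ℤ₃²` and weight(`f`) `= 3`. Then (a) the orbits of order
`9` give types with rank(`f`) `= 8` and (b) there are twelve `f` in four `ℤ₃²`-orbits of order `3`."**  Among the
`84` CM types of weight `3` (three points in `ℤ₃²`), exactly `72 = 8 · 9` lie in orbits of order `9` (primitive)
and `12 = 4 · 3` in orbits of order `3` (the cosets of the four `ℤ₃`); by `typeRank_eq_eight_of_primitive_of_weight_three`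
the `72` all have rank `8`, by `typeRank_eq_four_of_exists_isStableUnder_of_weight` the `12` have rank `4`.
[cite: Dodson1987, Prop. 4.4 (2)] -/
theorem ncard_weight_three (hτ : orderOf τ = 3) (hκ : orderOf κ = 3) (hτκ : κ ∉ Subgroup.zpowers τ)
    (hcard : Fintype.card G = 18) (hρ1 : ρ ≠ 1) (hρ2 : ρ * ρ = 1) :
    {Φ : Finset G | IsCMTypeWith ρ (Φ : Set G) ∧
      (Finset.univ.filter fun xy : ZMod 3 × ZMod 3 => τ ^ xy.1.val * κ ^ xy.2.val ∈ Φ).card = 3 ∧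
        ∀ u : G, u ≠ 1 → ¬ IsStableUnder Φ u}.ncard = 72 ∧
    {Φ : Finset G | IsCMTypeWith ρ (Φ : Set G) ∧
      (Finset.univ.filter fun xy : ZMod 3 × ZMod 3 => τ ^ xy.1.val * κ ^ xy.2.val ∈ Φ).card = 3 ∧
        ∃ u : G, u ≠ 1 ∧ IsStableUnder Φ u}.ncard = 12 := by
  have hcard' : Fintype.card G = 2 * 3 ^ 2 := by rw [hcard]; norm_num
  have hdict : ∀ Φ : Finset G, IsCMTypeWith ρ (Φ : Set G) →
      ((∀ u : G, u ≠ 1 → ¬ IsStableUnder Φ u) ↔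
        ¬ (∀ x y : ZMod 3, x ∈ rowSet 3 3 Φ τ κ y ↔ x + 1 ∈ rowSet 3 3 Φ τ κ y) ∧
          ∀ j : ZMod 3, ¬ ∀ x y : ZMod 3, x ∈ rowSet 3 3 Φ τ κ y ↔ x + j ∈ rowSet 3 3 Φ τ κ (y + 1)) := by
    intro Φ h
    rw [forall_not_isStableUnder_iff (by norm_num) hτ hκ hτκ hcard' h, isStableUnder_iff_rowSet (by norm_num) hτ hκ
      hτκ hcard' h]
    simp_rw [isStableUnder_diag_iff_rowSet (by norm_num) hτ hκ hτκ hcard' h]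
  obtain ⟨h72, h12⟩ := card_rows_weight_three
  constructor
  · rw [← h72]
    refine ncard_cmTypes_sep_eq_card_filter (p := 3) (by norm_num) hτ hκ hτκ hcard' hρ1 hρ2 _ _ fun Φ h => ?_
    rw [weight_eq_sum_card_rowSet, hdict Φ h]
  · rw [← h12]
    refine ncard_cmTypes_sep_eq_card_filter (p := 3) (by norm_num) hτ hκ hτκ hcard' hρ1 hρ2 _ _ fun Φ h => ?_
    rw [weight_eq_sum_card_rowSet, ← hdict Φ h]
    simp only [not_forall, not_not, exists_prop]

end Three

end ElemSq

end CyclicCMType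

end Literature.NumberTheory.ComplexMultiplication
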